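import Mathlib
import Literature.NumberTheory.LFunctions.SuzukiSingleOperatorKernelProofs
import Summits.RiemannHypothesis.RiemannHypothesis.Theorems.DeBrangesSuzukiDoorLaplaceWindow
import Summits.RiemannHypothesis.RiemannHypothesis.Theorems.SuzukiWeightedDoorDefs

/-!
# SuzukiWeightedDoor — the RH-FREE rung `η > 1/2` of the growth-abscissa ladder, PROVED (BC5 witness)

RH-FREE THEOREM `weightedWitness_of_half_lt`: for every `θ > 10` and every `η > 1/2`,
`x ↦ e^{−ηx} W_θ(x) ∈ L²(ℝ)` (`SuzukiWeightedDoor.WeightedWitness θ η`).  From the tree's growth bound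
`Literature.NumberTheory.LFunctions.abs_limKernel_le` (`|K_θ(x)| ≤ D_b e^{bx}`, every `b > 1/2`, [Su20] Thm 1.2 (K-ii)),
(K-iii) `Suzuki2020_thm12_Kiii` and continuity `Suzuki2020_thm12_continuous`, through the generic weighted-window lemma
`memLp_weightedWindow`.  It is the value `η* ≤ 1/2` of the growth abscissa, i.e. the PNT-line end (`XiZeroFreeAbove 1`)
of the identity `GrowthAbscissaIdentity`; nothing here bears on the truth of RH.
(Kit file: needs `Theorems/SuzukiWeightedDoorDefs.lean` landed first; checked jointly in `DefsPlusRung_check.lean`, farm rc 0.)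
-/

set_option linter.dupNamespace false

noncomputable section

open MeasureTheory Set Filter

namespace Summit.RiemannHypothesis.RiemannHypothesis.Theorems.SuzukiWeightedDoorRung

open Literature.NumberTheory.LFunctions

/-- Generic weighted-window lemma (RH-FREE real analysis): a continuous kernel vanishing on `(−∞,0)` with
`|K(x)| ≤ D e^{bx}` (`x ≥ 0`, `0 ≤ b < η`) has `e^{−ηx} ∫_{(0,1)} K(x+y) dy ∈ L²(ℝ)`. -/
theorem memLp_weightedWindow {K : ℝ → ℝ} (hKc : Continuous K) (hK0 : ∀ x : ℝ, x < 0 → K x = 0)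
    {D b η : ℝ} (hb : 0 ≤ b) (hbη : b < η) (hD : ∀ x : ℝ, 0 ≤ x → |K x| ≤ D * Real.exp (b * x)) :
    MemLp (fun x : ℝ => Real.exp (-η * x) * ∫ y in Ioo (0 : ℝ) 1, K (x + y)) 2 volume := by
  -- measurability of the window average (Fubini measurability of a continuous integrand)
  have hWm : AEStronglyMeasurable (fun x : ℝ => ∫ y in Ioo (0 : ℝ) 1, K (x + y)) volume := by
    have h : StronglyMeasurable (Function.uncurry fun x y : ℝ => K (x + y)) :=
      (hKc.comp (continuous_fst.add continuous_snd)).stronglyMeasurable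
    exact (h.integral_prod_right (ν := volume.restrict (Ioo (0 : ℝ) 1))).aestronglyMeasurable
  have hfm : AEStronglyMeasurable
      (fun x : ℝ => Real.exp (-η * x) * ∫ y in Ioo (0 : ℝ) 1, K (x + y)) volume :=
    (Real.continuous_exp.comp (continuous_const.mul continuous_id)).aestronglyMeasurable.mul hWm
  -- the dominating function
  set C : ℝ := D * Real.exp b with hC_def
  have hC0 : 0 ≤ C := by
    have h0 := hD 0 le_rfl
    simp only [mul_zero, Real.exp_zero, mul_one] at h0
    exact mul_nonneg ((abs_nonneg _).trans h0) (Real.exp_pos _).le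
  set g : ℝ → ℝ := (Ioi (-2 : ℝ)).indicator fun x => C * Real.exp ((b - η) * x) with hg_def
  have hg_nonneg : ∀ x, 0 ≤ g x := fun x => by
    simp only [hg_def]; exact Set.indicator_nonneg (fun y _ => by positivity) _
  -- g ∈ L²
  have hgm : AEStronglyMeasurable g volume := by
    refine AEStronglyMeasurable.indicator ?_ measurableSet_Ioi
    exact (continuous_const.mul (Real.continuous_exp.comp (continuous_const.mul continuous_id))).aestronglyMeasurable
  have hg2 : MemLp g 2 volume := by
    rw [memLp_two_iff_integrable_sq hgm]
    have hsq : (fun x => g x ^ 2) = (Ioi (-2 : ℝ)).indicator fun x => C ^ 2 * Real.exp ((2 * (b - η)) * x) := by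
      funext x
      by_cases hx : x ∈ Ioi (-2 : ℝ)
      · simp only [hg_def, indicator_of_mem hx, mul_pow, ← Real.exp_nat_mul]; ring_nf
      · simp only [hg_def, indicator_of_notMem hx]; ring
    rw [hsq, integrable_indicator_iff measurableSet_Ioi]
    exact ((integrableOn_exp_mul_Ioi (by linarith) _).const_mul _)
  -- pointwise domination
  have hdom : ∀ x : ℝ, ‖Real.exp (-η * x) * ∫ y in Ioo (0 : ℝ) 1, K (x + y)‖ ≤ ‖g x‖ := by
    intro x
    rw [Real.norm_of_nonneg (hg_nonneg x)]
    by_cases hx : x ∈ Ioi (-2 : ℝ)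
    · have hW : |∫ y in Ioo (0 : ℝ) 1, K (x + y)| ≤ C * Real.exp (b * x) := by
        have h := norm_setIntegral_le_of_norm_le_const (μ := volume) (s := Ioo (0 : ℝ) 1)
          (f := fun y => K (x + y)) (C := C * Real.exp (b * x)) (by simp) fun y hy => by
            rw [Real.norm_eq_abs]
            exact SuzukiDoor.abs_shift_le_of_expBound hK0 hb hD hy
        simpa [Real.norm_eq_abs, Measure.real, Real.volume_Ioo] using h
      rw [hg_def, indicator_of_mem hx, norm_mul, Real.norm_of_nonneg (Real.exp_pos _).le, Real.norm_eq_abs]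
      calc Real.exp (-η * x) * |∫ y in Ioo (0 : ℝ) 1, K (x + y)|
          ≤ Real.exp (-η * x) * (C * Real.exp (b * x)) :=
            mul_le_mul_of_nonneg_left hW (Real.exp_pos _).le
        _ = C * Real.exp ((b - η) * x) := by
            rw [show (b - η) * x = -η * x + b * x by ring, Real.exp_add]; ring
    · have hx' : x ≤ -1 := by simp only [mem_Ioi, not_lt] at hx; linarith
      rw [SuzukiDoor.window_eq_zero_of_le hK0 hx', mul_zero, norm_zero]
      exact hg_nonneg x
  exact hg2.of_le hfm (Eventually.of_forall hdom)

/-- **THE RH-FREE RUNG η > 1/2, PROVED**: `RungAboveHalf` of the v5 ladder «SuzukiWeightedDoor». -/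
theorem weightedWitness_of_half_lt : ∀ θ : ℝ, 10 < θ → ∀ η : ℝ, 1 / 2 < η →
    SuzukiWeightedDoor.WeightedWitness θ η := by
  intro θ hθ η hη
  show MemLp (fun x : ℝ => Real.exp (-η * x) * ∫ y in Ioo (0 : ℝ) 1, limKernel θ (x + y)) 2 volume
  have hθ1 : 1 < θ := by linarith
  -- pick 1/2 < b < η
  obtain ⟨D, -, hD⟩ := abs_limKernel_le hθ1 (b := (1 / 2 + η) / 2) (by linarith)
  have h := memLp_weightedWindow (Suzuki2020_thm12_continuous hθ1) (fun x hx => Suzuki2020_thm12_Kiii hθ1 hx)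
    (b := (1 / 2 + η) / 2) (η := η) (by linarith) (by linarith) (fun x _ => hD x)
  exact h

end Summit.RiemannHypothesis.RiemannHypothesis.Theorems.SuzukiWeightedDoorRung

end
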